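import Literature.AnabelianGeometry.AbsoluteAnabelian.AbsTopII.BelyiCuspidalizationDatum
import Literature.AnabelianGeometry.AbsoluteAnabelian.AbsTopII.BelyiCuspidalizationChainUSchemaScope
import Literature.AnabelianGeometry.AbsoluteAnabelian.AbsTopII.BelyiCuspidalizationChainUPointPreserving
import HarnessLib

/-!
# [AbsTopII] Cor 3.7″ / Cor 3.8 read INSIDE A DATUM (`BelyiDatumModel.toBelyiModel`): the separation /
# scope certificate of F-f064-1 at DATUM level — what datum-feeding closes and what it leaves free

S. Mochizuki, *Topics in Absolute Anabelian Geometry II* [AbsTopII] (bib `MochizukiAbsTopII2013`;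
manuscript pagination, lit key `paper:url-585b8d0ad0d9`): Ex 3.6 pp. 71–72, Cor 3.7 pp. 72–73, Cor 3.8
p. 74; [AbsTopI] (`MochizukiAbsTopI2012`) Def 4.2 (iii) pp. 49–50 ((3_Π)/(c)), Def 4.6 pp. 55–56.

PROOF-ONLY companion (no definition / instance / structure) of abc-iut-L4-t6's
`AbsTopII/BelyiCuspidalizationDatum.lean` (p439386, row «COR37-DATUM-RETYPE», RULING #8c: the NF-rational
opens READ INSIDE THE DATUM as `(U, ι, ψ)` and the induced free-data model `toBelyiModel`), cell abc-iut,
seat abc-iut-f-064 (author of the F-f064-1 certificates p429725 / p434894 / p437729, which exploited the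
FREE fields `BelyiModel.NFOpen / cuspOf`); row «COR37-DATUM-CERT».  QUESTION: does feeding the opens from
the datum close the separation?  ANSWER, in the kernel: NO for the ∀-closures; the residual freedom is
located exactly.  PROVED here:
* `BelyiDatumModel.exists_separation_model` — ONE junk DATUM model over the REAL field `ℚ_2` (universe
  `0`): chain-full, rel-isom-DGC; the `EllipticDatumModel` flags taken EQUAL to their laws ("finite
  étale" := every representative injective with open image, "open immersion" := every representative
  surjective — nothing flagged by fiat); members `X₁ ≅ X₂` (isomorphic IN the datum), `Π = G × G ↠ G`,
  `IsCor37Member` UNCONDITIONALLY; NO cusp recorded anywhere; a DATUM open immersion `ι : U → X₁` with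
  representative `ψ = pr₁ : (G × G) × G ↠ G × G` (surjective, NOT injective); every datum NF-open of `X₂`
  bijective (the datum carries no non-isomorphism into `X₂`);
* `exists_not_toBelyiModel_cor_3_7''_and_not_cor_3_8`, `not_forall_toBelyiModel_cor_3_7''`
  (`…_of_hypotheses`), `not_forall_toBelyiModel_cor_3_8` — the ∀-closures over `(𝒟, M : BelyiDatumModel 𝒟)`
  are REFUTED: after datum-feeding both facts remain HYPOTHESES on `(𝒟, M)`, bindable per instance (R5);
* instance forms: `toBelyiModel_cor_3_7''_of_ψ_injective` (via p437737) and the NON-vacuous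
  `toBelyiModel_cor_3_8_of_ψ_bijective` (`φ_U := ψ₂⁻¹ ∘ φ ∘ ψ₁`, unique on the nose);
* the LOCATION of the residual freedom: `NFOpen.ψ_injective_of_ker_le` — if `Ker [π₁(ι)]` lies in the
  closed normal subgroup generated by the cuspidal decomposition groups OF `U` (the (3_Π)/(c) shape),
  then at empty cuspidal data `ψ` is injective; `EllipticDatumModel`'s only open-immersion law is
  surjectivity, and at cusp-free data this law DECIDES both facts
  (`toBelyiModel_cor_3_7''_of_ker_le_of_isEmpty_cusp`, `toBelyiModel_cor_3_8_of_ker_le_of_isEmpty_cusp`: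
  law ⇒ both hold; no law ⇒ the separation model).  Not typed here (DEFS-FREEZE; a typer's call).

READING (honest framing): statements about OUR typed interfaces; the model is junk no étale `π₁` would
supply (FOUNDATIONS row 12: no cusp recorded on a "curve of strictly Belyi type", an "open immersion"
identifying points; for Cor 3.8, `X₁ ≅ X₂` in the datum yet no non-isomorphism into `X₂` — a
`RelativeAnabelianDatum` carries no composition).  NOTHING in print is contradicted; refuted-as-schema ≠
refuted-in-print; no side taken on [IUTchIII] Cor 3.12; typed ≠ proved. -/

open CategoryTheory Topology
open scoped Pointwise

universe u

namespace Literature.AnabelianGeometry.AbsoluteAnabelian.AbsTopII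

open Literature.AlgebraicGeometry.Frobenioids (IsSlimGroup)
open FundamentalExtension
open AbsTopI (ConstructionDataClass)
open AbsTopIII (IsGeneralizedSubpadicFor IsSubpadicFor cyclotomicChar)
open AugmentedProfiniteGrp

/-! ## Representatives of one outer homomorphism share surjectivity / bijectivity -/

section Representatives

variable {G : ProfiniteGrp.{u}} {A B : AugmentedProfiniteGrp G}

/-- Surjectivity is a property of the OUTER homomorphism: any representative of the class of a
surjective homomorphism over `G` is surjective (it is a `Δ`-conjugate). [cite: MochizukiAbsTopI2012, Def 4.6 (ii) p.56] -/
theorem HomOver.surjective_of_mk_eq_mk {φ ψ : HomOver A B}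
    (h : OuterHom.mk ψ = OuterHom.mk φ) (hφ : Function.Surjective φ.toHom) :
    Function.Surjective ψ.toHom := by
  obtain ⟨g, hg, rfl⟩ := OuterHom.mk_eq_mk.mp h.symm
  intro y
  obtain ⟨x, hx⟩ := hφ (g⁻¹ * y * g)
  refine ⟨x, ?_⟩
  rw [HomOver.conj_apply, hx]
  group

/-- Bijectivity is a property of the OUTER homomorphism (`OuterHom.IsIso` is well defined).
[cite: MochizukiAbsTopI2012, Def 4.6 (ii) p.56] -/
theorem HomOver.bijective_of_mk_eq_mk {φ ψ : HomOver A B}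
    (h : OuterHom.mk ψ = OuterHom.mk φ) (hφ : Function.Bijective φ.toHom) :
    Function.Bijective ψ.toHom := by
  have hiso : (OuterHom.mk φ).IsIso := (OuterHom.isIso_mk φ).mpr hφ
  rw [← h] at hiso
  exact (OuterHom.isIso_mk ψ).mp hiso

end Representatives

/-! ## The separation model, at DATUM level -/

/-- **The SEPARATION MODEL read inside a datum** (universe `0`): a class `𝒟` over the REAL field `ℚ_2`
(one base, chain-full, rel-isom-DGC) and a `BelyiDatumModel` over it such that
* the model's flags ARE their laws: `IsOpenImmersion f` iff every representative of `[π₁(f)]` is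
  surjective (likewise "finite étale" := injective with open image) — nothing flagged by fiat;
* the members (`Mem`) are the objects `X₁ ≅ X₂` (isomorphic IN the datum), `Π = G × G ↠ G`,
  `G := Gal(ℚ̄_2/ℚ_2)`, each satisfying the standing hypotheses `IsCor37Member` UNCONDITIONALLY
  ([Tpcs] Lem 4.14 / [AbsTopI] Ex 4.8 (i) kernel theorems, `Padic.infinite_absoluteGaloisGroup`);
* NO cusp is recorded on any object;
* `X₁` carries a DATUM NF-open `O₁ = (U, ι, ψ)` with `ψ = pr₁ : (G × G) × G ↠ G × G` NOT injective,
  while every datum NF-open of `X₂` has bijective `ψ`;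
* some `φ : Π₁ ⥲ Π₂` with `φ(Δ₁) = Δ₂` exists (the identity).
Every "•-tail computes `Π_U ↠ Π_V`" form of Cor 3.7 and the transport form of Cor 3.8 fail here for
`M.toBelyiModel` (next theorem). [cite: MochizukiAbsTopII2013, Cor 3.7 pp.72-73] -/
theorem BelyiDatumModel.exists_separation_model :
    ∃ (𝒟 : ConstructionDataClass.{0}) (M : BelyiDatumModel 𝒟) (b : 𝒟.Base)
      (X₁ X₂ : (𝒟.datum b).Obj) (O₁ : M.NFOpen b X₁),
      𝒟.IsChainFull ∧ 𝒟.RelIsomDGC ∧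
      (∀ {b : 𝒟.Base} {A B : (𝒟.datum b).Obj} (f : (𝒟.datum b).Hom A B),
        M.IsOpenImmersion f ↔ ∀ ψ : HomOver ((𝒟.datum b).grp A) ((𝒟.datum b).grp B),
          OuterHom.mk ψ = (𝒟.datum b).outerHom f → Function.Surjective ψ.toHom) ∧
      (∀ (b : 𝒟.Base) (X : (𝒟.datum b).Obj), 𝒟.Mem b X → M.toBelyiModel.IsCor37Member b X) ∧
      𝒟.Mem b X₁ ∧ 𝒟.Mem b X₂ ∧ (∃ f : (𝒟.datum b).Hom X₁ X₂, (𝒟.datum b).IsIso f) ∧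
      (∀ (b : 𝒟.Base) (X : (𝒟.datum b).Obj), IsEmpty (M.cusps b X).Cusp) ∧
      ¬ Function.Injective O₁.ψ.toHom ∧
      (∀ O₂ : M.NFOpen b X₂, Function.Bijective O₂.ψ.toHom) ∧
      (∃ φ : ((𝒟.datum b).ext X₁).arith ≃ₜ* ((𝒟.datum b).ext X₂).arith,
        ((𝒟.datum b).ext X₁).geom.map φ.toMonoidHom = ((𝒟.datum b).ext X₂).geom) := by
  let Γ : ProfiniteGrp.{0} := absoluteGaloisGrp ℚ_[2]
  -- the members: `Π := G × G ↠ G` (second projection)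
  let P : AugmentedProfiniteGrp Γ :=
    { arith := ProfiniteGrp.of (Γ × Γ), aug := ContinuousMonoidHom.snd Γ Γ
      aug_surjective := fun g => ⟨(1, g), rfl⟩ }
  -- the open `U`: `Π_U := (G × G) × G ↠ G`
  let Q : AugmentedProfiniteGrp Γ :=
    { arith := ProfiniteGrp.of ((Γ × Γ) × Γ)
      aug := (ContinuousMonoidHom.snd Γ Γ).comp (ContinuousMonoidHom.fst (Γ × Γ) Γ)
      aug_surjective := fun g => ⟨((1, g), 1), rfl⟩ }
  -- `[π₁(U ↪ X₁)]` is represented by the first projection, over `G`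
  let ι₀ : HomOver Q P := ⟨ContinuousMonoidHom.fst (Γ × Γ) Γ, fun _ => rfl⟩
  -- objects: `none = U` (not a member), `some _ = X₁, X₂` (members)
  let grp : Option Bool → AugmentedProfiniteGrp Γ := fun o => o.elim Q fun _ => P
  let D : RelativeAnabelianDatum Γ :=
    { Obj := Option Bool
      Hom := fun A B => {q : OuterHom (grp A) (grp B) // (A ≠ none ∨ B = some false) → q.IsIso}
      IsIso := fun f => f.1.IsIso
      IsHyperbolicCurve := fun _ => True
      primes := Set.univ
      grp := grp
      outerHom := fun f => f.1 }
  let 𝒟 : ConstructionDataClass.{0} :=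
    { Base := PUnit.{1}
      fld := fun _ => ℚ_[2]
      instField := fun _ => inferInstance
      instCharZero := fun _ => inferInstance
      datum := fun _ => D
      Mem := fun _ X => X ≠ none
      IsHyperbolicOrbicurve := fun _ _ => True
      isHyperbolicOrbicurve_of_isHyperbolicCurve := fun _ _ _ => trivial
      chainTerms := fun _ _ => ∅ }
  let M : BelyiDatumModel 𝒟 :=
    { cusps := fun _ _ =>
        { Cusp := PEmpty.{1}
          Dcusp := fun x => x.elim
          Icusp := fun x => x.elim
          Icusp_eq := fun x => x.elim
          isClosed_Dcusp := fun x => x.elim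
          eq_of_conj := fun x => x.elim }
      IsFinEt := fun f => ∀ φ, OuterHom.mk φ = f.1 → Function.Injective φ.toHom ∧ φ.IsOpenHom
      isFinEt_injective := fun _ h φ hφ => h φ hφ
      IsOpenImmersion := fun f => ∀ ψ, OuterHom.mk ψ = f.1 → Function.Surjective ψ.toHom
      isOpenImmersion_surjective := fun _ h ψ hψ => h ψ hψ
      IsOncePuncturedElliptic := fun _ _ => True
      IsEllipticallyAdmissible := fun _ _ => True
      IsStrictlyBelyiType := fun _ _ => True
      IsDefinedOverNF := fun _ _ => True }
  have hfull : 𝒟.IsChainFull := fun _ _ _ _ ht => ((Set.mem_empty_iff_false _).mp ht).elim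
  have hGC : 𝒟.RelIsomDGC := fun _ _ _ _ _ =>
    ⟨fun f hf => hf, fun f _ f' _ h => Subtype.ext h, fun c hc => ⟨⟨c, fun _ => hc⟩, hc, rfl⟩⟩
  have hk : IsGeneralizedSubpadicFor ℚ_[2] 2 := (IsSubpadicFor.padic 2).isGeneralizedSubpadicFor
  have hΓ : IsSlimGroup Γ :=
    isSlimGroup_of_iso_absoluteGaloisGrp_of_isGeneralizedSubpadicFor_holds hk (Iso.refl _)
  -- `Δ = G × 1 ≅ G` is slim …
  let E₀ : FundamentalExtension.{0} := P.toExtension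
  let e : Γ ≃ₜ* ↥E₀.geom :=
    { toFun := fun g => ⟨(g, 1), rfl⟩
      invFun := fun x => x.1.1
      left_inv := fun _ => rfl
      right_inv := fun x => by
        obtain ⟨⟨g, h⟩, hx⟩ := x
        have hh : h = 1 := hx
        subst hh
        rfl
      map_mul' := fun g h => Subtype.ext (Prod.ext rfl (one_mul (1 : Γ)).symm)
      continuous_toFun := Continuous.subtype_mk (continuous_id.prodMk continuous_const) _
      continuous_invFun := continuous_fst.comp continuous_subtype_val }
  have hΔ : IsSlimGroup ↥E₀.geom := isSlimGroup_of_continuousMulEquiv e hΓ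
  -- … and nontrivial
  haveI : Infinite (Field.absoluteGaloisGroup ℚ_[2]) := Padic.infinite_absoluteGaloisGroup 2
  obtain ⟨σ, hσ⟩ := exists_ne (1 : Field.absoluteGaloisGroup ℚ_[2])
  have hne : E₀.geom ≠ ⊥ := by
    intro h
    have hmem : ((σ, 1) : Γ × Γ) ∈ E₀.geom := rfl
    rw [h] at hmem
    exact hσ (Prod.mk_eq_one.mp (Subgroup.mem_bot.mp hmem)).1
  have hX : ∀ x : Bool, M.toBelyiModel.IsCor37Member PUnit.unit (some x) := fun x =>
    M.toBelyiModel.isCor37Member_of_isGeneralizedSubpadicFor (Option.some_ne_none x) rfl trivial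
      hk hΔ hne
  -- the datum open immersion `ι : U → X₁`, `[π₁(ι)] = [pr₁]`
  have hι : ((none : Option Bool) ≠ none ∨ some true = some false) →
      (OuterHom.mk ι₀ : OuterHom Q P).IsIso := fun h =>
    h.elim (fun h => (h rfl).elim) fun h => absurd h (by decide)
  let ι : D.Hom none (some true) := ⟨OuterHom.mk ι₀, hι⟩
  have hι₀ : Function.Surjective ι₀.toHom := fun g => ⟨(g, 1), rfl⟩
  let O₁ : M.NFOpen PUnit.unit (some true) :=
    { U := none
      ι := ι
      isOpenImmersion := fun ψ hψ => HomOver.surjective_of_mk_eq_mk hψ hι₀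
      definedOverNF := trivial
      ψ := ι₀
      mk_ψ := rfl }
  -- `pr₁` kills the nontrivial element `((1, 1), σ)`
  have hninj : ¬ Function.Injective O₁.ψ.toHom := by
    intro hinj
    have h1 : O₁.ψ.toHom (((1, 1), σ) : (Γ × Γ) × Γ) = O₁.ψ.toHom 1 := rfl
    exact hσ (Prod.mk_eq_one.mp (hinj h1)).2
  -- every datum morphism INTO `X₂` induces an outer isomorphism, so every NF-open of `X₂` is bijective
  have hX₂ : ∀ O₂ : M.NFOpen PUnit.unit (some false), Function.Bijective O₂.ψ.toHom := fun O₂ => by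
    have h : (OuterHom.mk O₂.ψ).IsIso := by
      rw [O₂.mk_ψ]
      exact O₂.ι.2 (Or.inr rfl)
    exact (OuterHom.isIso_mk O₂.ψ).mp h
  -- `X₁ ≅ X₂` in the datum (the identity outer isomorphism)
  let id₀ : HomOver P P := ⟨ContinuousMonoidHom.id _, fun _ => rfl⟩
  have hid₀ : (OuterHom.mk id₀ : OuterHom P P).IsIso :=
    (OuterHom.isIso_mk id₀).mpr ⟨fun _ _ h => h, fun y => ⟨y, rfl⟩⟩
  let f₁₂ : D.Hom (some true) (some false) := ⟨OuterHom.mk id₀, fun _ => hid₀⟩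
  refine ⟨𝒟, M, PUnit.unit, some true, some false, O₁, hfull, hGC, fun _ => Iff.rfl, ?_,
    Option.some_ne_none true, Option.some_ne_none false, ⟨f₁₂, hid₀⟩,
    fun _ _ => inferInstanceAs (IsEmpty PEmpty.{1}), hninj, hX₂, ContinuousMulEquiv.refl _, ?_⟩
  · intro _ X hXmem
    obtain ⟨x, rfl⟩ := Option.ne_none_iff_exists'.mp hXmem
    exact hX x
  · ext x
    simp only [Subgroup.mem_map]
    constructor
    · rintro ⟨y, hy, rfl⟩
      exact hy
    · exact fun hx => ⟨x, hx, rfl⟩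

/-! ## The ∀-closures of the datum forms are REFUTED -/

/-- **At the separation model BOTH datum facts fail** (universe `0`): `¬ M.toBelyiModel.Cor_3_7''` — the
member `X₁` records no cusp while its datum open `U → X₁` identifies points (kernel form
`BelyiModel.not_cor_3_7''_of_isEmpty_cusp`, p437729, read through `toBelyiModel`) — and
`¬ M.toBelyiModel.Cor_3_8` — for `φ : Π₁ ⥲ Π₂` with `φ(Δ₁) = Δ₂` and `U_{X₁} := (U, ι, pr₁)` no datum
NF-open of `X₂` admits a compatible `φ_U`, since every `ψ₂` is bijective and `pr₁` is not injective.
[cite: MochizukiAbsTopII2013, Cor 3.8 p.74] -/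
theorem BelyiDatumModel.exists_not_toBelyiModel_cor_3_7''_and_not_cor_3_8 :
    ∃ (𝒟 : ConstructionDataClass.{0}) (M : BelyiDatumModel 𝒟),
      𝒟.IsChainFull ∧ 𝒟.RelIsomDGC ∧
      (∀ (b : 𝒟.Base) (X : (𝒟.datum b).Obj), 𝒟.Mem b X → M.toBelyiModel.IsCor37Member b X) ∧
      ¬ M.toBelyiModel.Cor_3_7'' ∧ ¬ M.toBelyiModel.Cor_3_8 := by
  obtain ⟨𝒟, M, b, X₁, X₂, O₁, hfull, hGC, -, hmem, h₁, h₂, -, hC, hninj, hbij, φ, hφ⟩ :=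
    BelyiDatumModel.exists_separation_model
  refine ⟨𝒟, M, hfull, hGC, hmem, ?_, fun h38 => ?_⟩
  · exact M.toBelyiModel.not_cor_3_7''_of_isEmpty_cusp hfull hGC (hmem b X₁ h₁) (hC b X₁) O₁ hninj
  · obtain ⟨l, hl, hcyc⟩ := (hmem b X₁ h₁).cyclotomic
    obtain ⟨O₂, ⟨φU, hφU⟩, -⟩ := h38 hfull hGC b b X₁ X₂ (hmem b X₁ h₁) (hmem b X₂ h₂)
      ⟨l, hl, hcyc, hcyc⟩ φ hφ O₁
    have key : ∀ x, O₂.ψ.toHom (φU x) = φ (O₁.ψ.toHom x) := fun x => hφU x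
    refine hninj fun x y hxy => φU.injective ((hbij O₂).1 ?_)
    rw [key, key, hxy]

/-- **Universal closure of the datum Cor 3.7 REFUTED** (universe `0`): it is not the case that
`M.toBelyiModel.Cor_3_7''` holds for every class `𝒟` and every `BelyiDatumModel` `M` over it — after
datum-feeding it is still a HYPOTHESIS ON `(𝒟, M)`, bindable per instance (the étale-`π₁` datum of
[AbsTopI] Ex 4.8 (i)); Cor 3.7 itself is not touched. [cite: MochizukiAbsTopII2013, Cor 3.7 pp.72-73] -/
theorem BelyiDatumModel.not_forall_toBelyiModel_cor_3_7'' :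
    ¬ ∀ (𝒟 : ConstructionDataClass.{0}) (M : BelyiDatumModel 𝒟), M.toBelyiModel.Cor_3_7'' := by
  intro H
  obtain ⟨𝒟, M, -, -, -, h37, -⟩ :=
    BelyiDatumModel.exists_not_toBelyiModel_cor_3_7''_and_not_cor_3_8
  exact h37 (H 𝒟 M)

/-- Sharper: the datum Cor 3.7 is not even implied by "`𝒟` chain-full with rel-isom-DGC and every member
satisfying the standing hypotheses" — the printed hypotheses of Cor 3.7 as typed.
[cite: MochizukiAbsTopII2013, Cor 3.7 pp.72-73] -/
theorem BelyiDatumModel.not_forall_toBelyiModel_cor_3_7''_of_hypotheses :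
    ¬ ∀ (𝒟 : ConstructionDataClass.{0}) (M : BelyiDatumModel 𝒟),
      𝒟.IsChainFull → 𝒟.RelIsomDGC →
      (∀ (b : 𝒟.Base) (X : (𝒟.datum b).Obj), 𝒟.Mem b X → M.toBelyiModel.IsCor37Member b X) →
        M.toBelyiModel.Cor_3_7'' := by
  intro H
  obtain ⟨𝒟, M, hfull, hGC, hmem, h37, -⟩ :=
    BelyiDatumModel.exists_not_toBelyiModel_cor_3_7''_and_not_cor_3_8
  exact h37 (H 𝒟 M hfull hGC hmem)

/-- **Universal closure of the datum Cor 3.8 REFUTED** (universe `0`): `M.toBelyiModel.Cor_3_8` is a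
HYPOTHESIS ON `(𝒟, M)`, not a closed fact; Cor 3.8 itself is not touched.
[cite: MochizukiAbsTopII2013, Cor 3.8 p.74] -/
theorem BelyiDatumModel.not_forall_toBelyiModel_cor_3_8 :
    ¬ ∀ (𝒟 : ConstructionDataClass.{0}) (M : BelyiDatumModel 𝒟), M.toBelyiModel.Cor_3_8 := by
  intro H
  obtain ⟨𝒟, M, -, -, -, -, h38⟩ :=
    BelyiDatumModel.exists_not_toBelyiModel_cor_3_7''_and_not_cor_3_8
  exact h38 (H 𝒟 M)

/-! ## Instance forms: datum opens that remove no point -/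

variable {𝒟 : ConstructionDataClass.{u}}

namespace BelyiDatumModel

variable (M : BelyiDatumModel 𝒟)

/-- **Instance form of the datum Cor 3.7**: if every datum NF-open `(U, ι, ψ)` of every member satisfying
the standing hypotheses has `ψ : Π_U ↠ Π` INJECTIVE ("`U_X = X`"), then `M.toBelyiModel.Cor_3_7''` holds
(non-vacuously: the identity chain is realized, p437737 `BelyiModel.cor_3_7''_of_cuspOf_injective`).
TIGHT against the separation model, where the one non-injective datum open breaks it.
[cite: MochizukiAbsTopII2013, Cor 3.7 pp.72-73] -/
theorem toBelyiModel_cor_3_7''_of_ψ_injective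
    (hinj : ∀ (b : 𝒟.Base) (X : (𝒟.datum b).Obj), M.toBelyiModel.IsCor37Member b X →
      ∀ O : M.NFOpen b X, Function.Injective O.ψ.toHom) :
    M.toBelyiModel.Cor_3_7'' :=
  M.toBelyiModel.cor_3_7''_of_cuspOf_injective hinj

/-- **NON-VACUOUS instance form of the datum Cor 3.8**: if every datum NF-open has BIJECTIVE
`ψ : Π_U ⥲ Π` and every member satisfying the standing hypotheses has at least one datum NF-open, then
`M.toBelyiModel.Cor_3_8` holds: for `φ : Π₁ ⥲ Π₂` and `U_{X₁}` take any `U_{X₂}` and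
`φ_U := ψ₂⁻¹ ∘ φ ∘ ψ₁` (a continuous bijection of profinite groups is bicontinuous); it is compatible with
`φ`, and any compatible `φ_U'` equals it (`ψ₂` injective), so the uniqueness clause holds with `g = 1`.
The hypotheses "chain-full, rel-isom-DGC, `φ(Δ₁) = Δ₂`, common `l`" are not used.
[cite: MochizukiAbsTopII2013, Cor 3.8 p.74] -/
theorem toBelyiModel_cor_3_8_of_ψ_bijective
    (hbij : ∀ (b : 𝒟.Base) (X : (𝒟.datum b).Obj) (O : M.NFOpen b X), Function.Bijective O.ψ.toHom)
    (hne : ∀ (b : 𝒟.Base) (X : (𝒟.datum b).Obj), M.toBelyiModel.IsCor37Member b X →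
      Nonempty (M.NFOpen b X)) :
    M.toBelyiModel.Cor_3_8 := by
  intro _ _ b₁ b₂ X₁ X₂ _ h₂ _ φ _ O₁
  obtain ⟨O₂⟩ := hne b₂ X₂ h₂
  -- the bijective representatives as isomorphisms of profinite groups
  let e₁ : O₁.cuspidalization.ext.arith ≃ₜ* ((𝒟.datum b₁).ext X₁).arith :=
    { ((map_continuous O₁.ψ.toHom).homeoOfEquivCompactToT2
          (f := Equiv.ofBijective O₁.ψ.toHom (hbij b₁ X₁ O₁)) : _ ≃ₜ _) with
      map_mul' := map_mul O₁.ψ.toHom }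
  let e₂ : O₂.cuspidalization.ext.arith ≃ₜ* ((𝒟.datum b₂).ext X₂).arith :=
    { ((map_continuous O₂.ψ.toHom).homeoOfEquivCompactToT2
          (f := Equiv.ofBijective O₂.ψ.toHom (hbij b₂ X₂ O₂)) : _ ≃ₜ _) with
      map_mul' := map_mul O₂.ψ.toHom }
  have he₂ : ∀ y, O₂.ψ.toHom (e₂.symm y) = y := fun y => e₂.apply_symm_apply y
  refine ⟨O₂, ⟨e₁.trans (φ.trans e₂.symm), fun x => ?_⟩, fun φU φU' h h' => ⟨1, map_one _, fun x => ?_⟩⟩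
  · exact he₂ (φ (O₁.ψ.toHom x))
  · rw [one_mul, inv_one, mul_one]
    exact (hbij b₂ X₂ O₂).1 ((h' x).trans (h x).symm)

/-! ## Where the residual freedom sits: the kernel of a datum open immersion -/

/-- **The law that excludes the separation model.**  If, for a datum NF-open `(U, ι, ψ)`, the kernel of
`ψ : Π_U ↠ Π` lies in the closed normal subgroup generated by the cuspidal decomposition groups OF `U`
— the shape of [AbsTopI] Def 4.2 (iii) (3_Π)/(c) "`Ker(φ)` is topologically normally generated by a
cuspidal decomposition group `C` in `Δ_j`", the printed source of such kernels — then, when no cusp of `U`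
is recorded, `ψ` is injective.  `EllipticDatumModel`'s only open-immersion law is surjectivity; this is
the (untyped) law whose absence the separation model exploits. [cite: MochizukiAbsTopI2012, Def 4.2 (iii) p.50] -/
theorem NFOpen.ψ_injective_of_ker_le {b : 𝒟.Base} {X : (𝒟.datum b).Obj} (O : M.NFOpen b X)
    (hK : (O.ψ.toHom.toMonoidHom.ker : Subgroup ((𝒟.datum b).ext O.U).arith) ≤
      (Subgroup.normalClosure (⋃ c : (M.cusps b O.U).Cusp,
        ((M.cusps b O.U).Dcusp c : Set ((𝒟.datum b).ext O.U).arith))).topologicalClosure)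
    (hE : IsEmpty (M.cusps b O.U).Cusp) : Function.Injective O.ψ.toHom := by
  have hbot : Subgroup.normalClosure (⋃ c : (M.cusps b O.U).Cusp,
      ((M.cusps b O.U).Dcusp c : Set ((𝒟.datum b).ext O.U).arith)) ≤ ⊥ :=
    Subgroup.normalClosure_le_normal (by rw [Set.iUnion_of_empty]; exact Set.empty_subset _)
  have hcl : (Subgroup.normalClosure (⋃ c : (M.cusps b O.U).Cusp,
      ((M.cusps b O.U).Dcusp c : Set ((𝒟.datum b).ext O.U).arith))).topologicalClosure ≤ ⊥ :=
    Subgroup.topologicalClosure_minimal _ hbot (by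
      rw [Subgroup.coe_bot]
      exact isClosed_singleton)
  have h : O.ψ.toHom.toMonoidHom.ker = ⊥ := le_bot_iff.mp (hK.trans hcl)
  intro x y hxy
  exact (MonoidHom.ker_eq_bot_iff _).mp h hxy

/-- **The kernel law DECIDES the datum Cor 3.7 at cusp-free data**: law + no cusp recorded ⇒ every `ψ`
injective ⇒ `M.toBelyiModel.Cor_3_7''` (whereas WITHOUT the law the separation model, on the same
cusp-free data, violates it). [cite: MochizukiAbsTopII2013, Cor 3.7 pp.72-73] -/
theorem toBelyiModel_cor_3_7''_of_ker_le_of_isEmpty_cusp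
    (hK : ∀ (b : 𝒟.Base) (X : (𝒟.datum b).Obj) (O : M.NFOpen b X),
      (O.ψ.toHom.toMonoidHom.ker : Subgroup ((𝒟.datum b).ext O.U).arith) ≤
        (Subgroup.normalClosure (⋃ c : (M.cusps b O.U).Cusp,
          ((M.cusps b O.U).Dcusp c : Set ((𝒟.datum b).ext O.U).arith))).topologicalClosure)
    (hE : ∀ (b : 𝒟.Base) (X : (𝒟.datum b).Obj), IsEmpty (M.cusps b X).Cusp) :
    M.toBelyiModel.Cor_3_7'' :=
  M.toBelyiModel_cor_3_7''_of_ψ_injective fun b X _ O =>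
    NFOpen.ψ_injective_of_ker_le M O (hK b X O) (hE b O.U)

/-- **… and the datum Cor 3.8** (every member having a datum NF-open): law + no cusp ⇒ every `ψ`
bijective (surjective by the open-immersion law). [cite: MochizukiAbsTopII2013, Cor 3.8 p.74] -/
theorem toBelyiModel_cor_3_8_of_ker_le_of_isEmpty_cusp
    (hK : ∀ (b : 𝒟.Base) (X : (𝒟.datum b).Obj) (O : M.NFOpen b X),
      (O.ψ.toHom.toMonoidHom.ker : Subgroup ((𝒟.datum b).ext O.U).arith) ≤
        (Subgroup.normalClosure (⋃ c : (M.cusps b O.U).Cusp,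
          ((M.cusps b O.U).Dcusp c : Set ((𝒟.datum b).ext O.U).arith))).topologicalClosure)
    (hE : ∀ (b : 𝒟.Base) (X : (𝒟.datum b).Obj), IsEmpty (M.cusps b X).Cusp)
    (hne : ∀ (b : 𝒟.Base) (X : (𝒟.datum b).Obj), M.toBelyiModel.IsCor37Member b X →
      Nonempty (M.NFOpen b X)) :
    M.toBelyiModel.Cor_3_8 :=
  M.toBelyiModel_cor_3_8_of_ψ_bijective
    (fun b X O => ⟨NFOpen.ψ_injective_of_ker_le M O (hK b X O) (hE b O.U),
      M.isOpenImmersion_surjective O.ι O.isOpenImmersion O.ψ O.mk_ψ⟩) hne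

end BelyiDatumModel

end Literature.AnabelianGeometry.AbsoluteAnabelian.AbsTopII
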